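import Mathlib
import Literature.MathematicalPhysics.StatisticalMechanics.Crystallization
import Literature.MathematicalPhysics.StatisticalMechanics.LennardJonesClusters
import Literature.MathematicalPhysics.StatisticalMechanics.OneCrossingMixture
import Summits.AtomisticToContinuum.Crystallization.Theses.ReggeStarCoercivity

/-!
# Route `ReggeStarCoercivity`, crux stmt-AtomisticToContinuum-13601 `StabilityConstantTwelve`
# — line `Sketch`, stub `stub_engine` (one-crossing Gaussian-subordination engine)

If the density `a` is `≤ 0` on `(0,t₀)`, `≥ 0` on `[t₀,∞)`, integrable on `(0,∞)` together with
`a(t) t^{-3/2}`, with `∫_0^∞ a(t) t^{-3/2} dt ≥ 0`, and `t ↦ t^{3/2} Σ_{i,j} e^{-t|x_i-x_j|²}` is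
non-decreasing on `(0,∞)`, then `Σ_{i,j} ∫_0^∞ e^{-t|x_i-x_j|²} a(t) dt ≥ 0`.

Proof (Chebyshev rearrangement).  Put `S(t) := Σ_{i,j} e^{-t|x_i-x_j|²}` and
`K := t₀^{3/2} S(t₀) ≥ 0`.  After swapping the finite sums with the integral, the claim is
`∫_{(0,∞)} S(t) a(t) dt ≥ 0`.  Pointwise on `(0,∞)` one has `S(t) a(t) ≥ K · a(t) t^{-3/2}`:
for `t < t₀`, `a(t) ≤ 0` and monotonicity at `(t, t₀)` gives `S(t) ≤ K t^{-3/2}`; for `t ≥ t₀`,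
`a(t) ≥ 0` and monotonicity at `(t₀, t)` gives `K t^{-3/2} ≤ S(t)`.  Integrating,
`∫ S a ≥ K ∫ a(t) t^{-3/2} dt ≥ 0`.
-/

noncomputable section

namespace Summit.AtomisticToContinuum.Crystallization.Theorems

open MeasureTheory Set Real
open scoped Nat
open Literature.MathematicalPhysics.StatisticalMechanics

/-- Integrability of the Gaussian-weighted density `t ↦ e^{-t c} a(t)` on `(0,∞)` for `c ≥ 0`:
the weight is continuous and bounded by `1` there. -/
theorem stub_engine_integrableOn_exp_mul (a : ℝ → ℝ) (ha : IntegrableOn a (Ioi 0)) {c : ℝ}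
    (hc : 0 ≤ c) : IntegrableOn (fun t => Real.exp (-(t * c)) * a t) (Ioi 0) := by
  refine Integrable.bdd_mul (c := 1) ha ?_ ?_
  · exact (Real.continuous_exp.comp (continuous_id.mul continuous_const).neg).aestronglyMeasurable
  · refine (ae_restrict_iff' measurableSet_Ioi).2 (ae_of_all _ fun t ht => ?_)
    rw [Real.norm_eq_abs, abs_of_nonneg (Real.exp_nonneg _), Real.exp_le_one_iff]
    exact neg_nonpos.2 (mul_nonneg (le_of_lt ht) hc)

/-- Pointwise Chebyshev step of the one-crossing engine.  If `a t ≤ 0` for `0 < t < t₀`,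
`a t ≥ 0` for `t ≥ t₀`, and `t ↦ t^{3/2} S(t)` is non-decreasing on `(0,∞)`, then for every
`t > 0`, `t₀^{3/2} S(t₀) · (a(t) t^{-3/2}) ≤ S(t) a(t)`. -/
theorem stub_engine_pointwise (a S : ℝ → ℝ) (t₀ : ℝ) (ht₀ : 0 < t₀)
    (hneg : ∀ t ∈ Set.Ioo 0 t₀, a t ≤ 0) (hpos : ∀ t, t₀ ≤ t → 0 ≤ a t)
    (hmono : ∀ t₁ t₂ : ℝ, 0 < t₁ → t₁ ≤ t₂ →
      t₁ ^ ((3 : ℝ) / 2) * S t₁ ≤ t₂ ^ ((3 : ℝ) / 2) * S t₂)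
    (t : ℝ) (ht : 0 < t) :
    t₀ ^ ((3 : ℝ) / 2) * S t₀ * (a t * t ^ (-(3 / 2 : ℝ))) ≤ S t * a t := by
  have htp : 0 < t ^ ((3 : ℝ) / 2) := Real.rpow_pos_of_pos ht _
  have hrw : t ^ (-(3 / 2 : ℝ)) = (t ^ ((3 : ℝ) / 2))⁻¹ := Real.rpow_neg ht.le _
  rw [hrw]
  rcases lt_or_ge t t₀ with hlt | hge
  · -- `t < t₀`: `a t ≤ 0` and `S t ≤ K / t^{3/2}`
    have hat : a t ≤ 0 := hneg t ⟨ht, hlt⟩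
    have hm := hmono t t₀ ht hlt.le
    have hS : S t ≤ t₀ ^ ((3 : ℝ) / 2) * S t₀ * (t ^ ((3 : ℝ) / 2))⁻¹ := by
      rw [← div_eq_mul_inv, le_div_iff₀ htp, mul_comm]
      exact hm
    calc t₀ ^ ((3 : ℝ) / 2) * S t₀ * (a t * (t ^ ((3 : ℝ) / 2))⁻¹)
        = t₀ ^ ((3 : ℝ) / 2) * S t₀ * (t ^ ((3 : ℝ) / 2))⁻¹ * a t := by ring
      _ ≤ S t * a t := mul_le_mul_of_nonpos_right hS hat
  · -- `t₀ ≤ t`: `a t ≥ 0` and `K / t^{3/2} ≤ S t`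
    have hat : 0 ≤ a t := hpos t hge
    have hm := hmono t₀ t ht₀ hge
    have hS : t₀ ^ ((3 : ℝ) / 2) * S t₀ * (t ^ ((3 : ℝ) / 2))⁻¹ ≤ S t := by
      rw [← div_eq_mul_inv, div_le_iff₀ htp, mul_comm (S t)]
      exact hm
    calc t₀ ^ ((3 : ℝ) / 2) * S t₀ * (a t * (t ^ ((3 : ℝ) / 2))⁻¹)
        = t₀ ^ ((3 : ℝ) / 2) * S t₀ * (t ^ ((3 : ℝ) / 2))⁻¹ * a t := by ring
      _ ≤ S t * a t := mul_le_mul_of_nonneg_right hS hat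

/-- STUB S3a (one-crossing engine). If the density `a` is `≤ 0` on `(0,t₀)`, `≥ 0` on `[t₀,∞)`,
integrable, with `∫_0^∞ a(t) t^{-3/2} dt ≥ 0`, and `t^{3/2} Σ_{i,j} e^{-t|x_i-x_j|²}` is
non-decreasing in `t`, then `Σ_{i,j} ∫_0^∞ e^{-t|x_i-x_j|²} a(t) dt ≥ 0`. -/
theorem stub_engine (a : ℝ → ℝ) (t₀ : ℝ) (ht₀ : 0 < t₀)
    (hneg : ∀ t ∈ Set.Ioo 0 t₀, a t ≤ 0) (hpos : ∀ t, t₀ ≤ t → 0 ≤ a t)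
    (ha : IntegrableOn a (Ioi 0))
    (ha' : IntegrableOn (fun t => a t * t ^ (-(3 / 2 : ℝ))) (Ioi 0))
    (hmass : 0 ≤ ∫ t in Ioi 0, a t * t ^ (-(3 / 2 : ℝ)))
    (hmono : ∀ (N : ℕ) (x : Fin N → EuclideanSpace ℝ (Fin 3)) (t₁ t₂ : ℝ), 0 < t₁ → t₁ ≤ t₂ →
      t₁ ^ ((3 : ℝ) / 2) * ∑ i, ∑ j, Real.exp (-(t₁ * ‖x i - x j‖ ^ 2)) ≤
        t₂ ^ ((3 : ℝ) / 2) * ∑ i, ∑ j, Real.exp (-(t₂ * ‖x i - x j‖ ^ 2)))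
    (N : ℕ) (x : Fin N → EuclideanSpace ℝ (Fin 3)) :
    0 ≤ ∑ i, ∑ j, ∫ t in Ioi 0, Real.exp (-(t * ‖x i - x j‖ ^ 2)) * a t := by
  -- abbreviations: the Gaussian pair sum `S` and the constant `K = t₀^{3/2} S(t₀)`
  set S : ℝ → ℝ := fun t => ∑ i, ∑ j, Real.exp (-(t * ‖x i - x j‖ ^ 2)) with hS_def
  have hS_nonneg : ∀ t, 0 ≤ S t := fun t =>
    Finset.sum_nonneg fun i _ => Finset.sum_nonneg fun j _ => Real.exp_nonneg _
  have hK_nonneg : 0 ≤ t₀ ^ ((3 : ℝ) / 2) * S t₀ :=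
    mul_nonneg (Real.rpow_nonneg ht₀.le _) (hS_nonneg t₀)
  -- integrability of each Gaussian-weighted summand
  have hint : ∀ i j : Fin N,
      IntegrableOn (fun t => Real.exp (-(t * ‖x i - x j‖ ^ 2)) * a t) (Ioi 0) :=
    fun i j => stub_engine_integrableOn_exp_mul a ha (sq_nonneg _)
  -- Step 1: swap the finite sums with the integral
  have hrow : ∀ i : Fin N,
      IntegrableOn (fun t => ∑ j, Real.exp (-(t * ‖x i - x j‖ ^ 2)) * a t) (Ioi 0) :=
    fun i => integrable_finsetSum Finset.univ fun j _ => hint i j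
  have hSa : IntegrableOn (fun t => S t * a t) (Ioi 0) := by
    have h := integrable_finsetSum (μ := volume.restrict (Ioi 0)) Finset.univ fun i _ => hrow i
    refine h.congr (ae_of_all _ fun t => ?_)
    simp only [hS_def, Finset.sum_mul]
  have hswap : (∑ i, ∑ j, ∫ t in Ioi 0, Real.exp (-(t * ‖x i - x j‖ ^ 2)) * a t) =
      ∫ t in Ioi 0, S t * a t := by
    have h1 : ∀ i : Fin N, (∑ j, ∫ t in Ioi 0, Real.exp (-(t * ‖x i - x j‖ ^ 2)) * a t) =
        ∫ t in Ioi 0, ∑ j, Real.exp (-(t * ‖x i - x j‖ ^ 2)) * a t := fun i =>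
      (integral_finsetSum Finset.univ fun j _ => hint i j).symm
    simp_rw [h1]
    rw [← integral_finsetSum Finset.univ fun i _ => hrow i]
    refine integral_congr_ae (ae_of_all _ fun t => ?_)
    simp only [hS_def, Finset.sum_mul]
  rw [hswap]
  -- Step 2 and 3: pointwise Chebyshev bound, then integrate
  have hpt : ∀ t ∈ Ioi (0 : ℝ),
      t₀ ^ ((3 : ℝ) / 2) * S t₀ * (a t * t ^ (-(3 / 2 : ℝ))) ≤ S t * a t := fun t ht =>
    stub_engine_pointwise a S t₀ ht₀ hneg hpos (fun t₁ t₂ h₁ h₁₂ => hmono N x t₁ t₂ h₁ h₁₂) t ht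
  calc (0 : ℝ) ≤ t₀ ^ ((3 : ℝ) / 2) * S t₀ * ∫ t in Ioi 0, a t * t ^ (-(3 / 2 : ℝ)) :=
        mul_nonneg hK_nonneg hmass
    _ = ∫ t in Ioi 0, t₀ ^ ((3 : ℝ) / 2) * S t₀ * (a t * t ^ (-(3 / 2 : ℝ))) :=
        (integral_const_mul _ _).symm
    _ ≤ ∫ t in Ioi 0, S t * a t :=
        setIntegral_mono_on (ha'.const_mul _) hSa measurableSet_Ioi hpt
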